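import Literature.Probability.RandomPlanarGeometry.SAWBridges
import Mathlib.Analysis.SpecialFunctions.Pow.Real
import HarnessLib

/-!
# Duminil-Copin–Hammond 2013: self-avoiding walk on `ℤ^d` is sub-ballistic

Topic `Literature/Probability/RandomPlanarGeometry` (continues `SAWCount.lean` / `SAWBridges.lean`: the
function model `saws d n` of the `n`-step self-avoiding walks from `0` on `ℤ^d`, `#saws d n = cₙ =
count d n`, bridges `bridges d n`, `bridgeCount d n = bₙ`, the connective constant
`connectiveConstant d = μ`). Source, read in the arXiv version (arXiv:1205.0401 = CMP 324 (2013) 401–423; locators below are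
`pNNNN:line` = chunk : line of the held text `paper:arxiv-1205.0401`):

H. Duminil-Copin, A. Hammond, *Self-avoiding walk is sub-ballistic*, Comm. Math. Phys. **324** (2013)
401–423.

* §1.1 (p0003:8–12): "Let `d ≥ 2`. For `u ∈ ℝ^d`, let `‖u‖` denote the Euclidean norm of `u`. … A walk
  of length `n ∈ ℕ` is a map `γ : {0,…,n} → ℤ^d` such that `(γ_i, γ_{i+1})` [is a nearest-neighbour
  bond] for each `i`. An injective walk is called self-avoiding. Let `SAW_n` denote the set of
  self-avoiding walks of length `n` that start at `0` and let `P_{SAW_n}` denote the uniform law on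
  `SAW_n`."
* **Theorem 1.1** (p0003:15–20): "Let `v > 0`. There exists `ε > 0` such that, for each `n ∈ ℕ`,
  `P_{SAW_n}( max{‖γ_k‖ : 0 ≤ k ≤ n} ≥ v n ) ≤ e^{-ε n}`."
* **Corollary 1.2** (p0003:24–29): "`lim_{n→∞} n^{-2} ⟨‖γ_n‖²⟩ = 0`."
* §2.2 (p0005:31–36, 61–65): bridges ("its first element attains uniquely the minimal `y`-coordinate
  on the walk; and its final element attains, not necessarily uniquely, the maximal `y`-coordinate"),
  renewal points ("the set `R_γ` of renewal points of `γ ∈ SAB_n` is the set of points of the form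
  `γ_i` with `i ∈ [0, n]`, for which `γ[0,i]` and `γ[i,n]` are bridges"), irreducible bridges ("a
  bridge `γ ∈ SAB_n` with `n ≥ 1` is said to be irreducible if `γ_k` is not a renewal point for any
  `k ∈ [1, n-1]`"); **Lemma 2.2 (Kesten)** (p0005:67–70): "`Σ_{γ ∈ iSAB} μ_c^{-|γ|} = 1`", which
  defines the probability measure `P_{iSAB}(γ) = μ_c^{-|γ|}` on the irreducible bridges from `0`
  (p0005:81–82).
* **Theorem 2.5** (p0006:29–30): "We have that `E_{iSAB}(|γ|) = ∞`."

## What is vendored, and a reading of Theorem 1.1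

Two NAMED FACTS, stated in the tree's vocabulary (`saws`, `count`, `bridges`, `connectiveConstant`;
the tree's bridges use the first coordinate `ω₁` where the source uses `y = u₂` — the same notion up
to the coordinate permutation `(u₁, u₂, …) ↦ (u₂, u₁, …)`, an automorphism of `ℤ^d` preserving `SAW_n`,
the Euclidean norm and `μ_c`):

* `DuminilCopinHammond2013_thm1_1` — Theorem 1.1, in the form **"there exist `ε > 0` and `n₀` such that
  the bound holds for all `n ≥ n₀`"**. READING NOTE (faithfulness): the sentence as printed says "for
  each `n ∈ ℕ`" with no threshold; read literally this is false for every `v ≤ 1` at `n = 1` (every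
  one-step walk has `max{‖γ_0‖, ‖γ_1‖} = 1 ≥ v · 1`, so the probability is `1 > e^{-ε}`) — see
  `dch_event_all_of_le_one` below, a proved two-line witness. The proof printed in §2.4 (p0006:60–64,
  p0007:1–13) is by contradiction with the *ballistic assumption* "`limsup_n n^{-1} log P_{SAB_n}(y(γ_n)
  ≥ v n) = 0` for some `v > 0`" (p0006:4–8): "if the conclusion of Theorem 1.1 is violated, the
  ballistic assumption must be verified" — i.e. what is established is `limsup_n n^{-1} log P_{SAW_n}(…)
  < 0` for every `v > 0`, which is exactly the eventual form vendored here (equivalently: `≤ C e^{-εn}`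
  for all `n` with some `C = C(v)`). We therefore vendor the eventual form and do NOT weaken anything
  the proof gives.
* `DuminilCopinHammond2013_thm2_5` — Theorem 2.5: the `P_{iSAB}`-expected length of an irreducible
  bridge is infinite, i.e. `Σ_n n · λ_n · μ^{-n} = +∞` (`λ_n` = number of `n`-step irreducible bridges
  from `0`), stated as non-summability of this series of nonnegative terms. (With Kesten's renewal
  theory this is the statement `b_n μ^{-n} → 0`; that corollary is not printed in the source and is not
  vendored.)

Local definitions (real `def`s with bodies): `euclidNorm` (the Euclidean norm on `ℤ^d = Fin d → ℤ`;
note that Mathlib's instance norm on `Fin d → ℤ` is the sup norm, which is NOT the printed one),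
`maxDisplacementEvent` (the walks with `max_{k ≤ n} ‖γ_k‖ ≥ v n`), `IsRenewalTime`,
`IsIrreducibleBridge`, `irreducibleBridges`, `irreducibleBridgeCount = λ_n`, with unfolding / sanity
lemmas (`euclidNorm_zero`, `euclidNorm_nonneg`, `sq_euclidNorm`, `euclidNorm_eq_one_of_adj_zero`,
`irreducibleBridges_subset_bridges`, `irreducibleBridgeCount_le_bridgeCount`,
`irreducibleBridges_one`, `one_le_irreducibleBridgeCount_one` (non-vacuity: `λ_1 = b_1 ≥ 1`),
`dch_event_all_of_le_one`).

## References

* H. Duminil-Copin, A. Hammond, *Self-avoiding walk is sub-ballistic*, Comm. Math. Phys. 324 (2013)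
  401–423, doi:10.1007/s00220-013-1811-1, arXiv:1205.0401 — Thm 1.1, Cor. 1.2, §2.2, Lemma 2.2, Thm 2.5,
  §2.4. [DuminilCopinHammond2013]
* N. Madras, G. Slade, *The Self-Avoiding Walk*, Birkhäuser (1993), Def. 1.2.4 (bridges), §4.2
  (irreducible bridges, Kesten's renewal). [MadrasSlade1993]
* H. Kesten, *On the number of self-avoiding walks*, J. Math. Phys. 4 (1963) 960–969. [Kesten1963SAW]
-/

noncomputable section

open Filter Topology Literature.Probability.LatticeModels Literature.Probability.Percolation SimpleGraph
open scoped BigOperators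

namespace Literature.Probability.RandomPlanarGeometry.SAW.Zd

variable {d : ℕ}

/-! ### The Euclidean norm on `ℤ^d` -/

/-- The Euclidean norm `‖u‖ = (Σ_i u_i²)^{1/2}` of a site `u ∈ ℤ^d` ("`‖u‖` denote[s] the Euclidean
norm of `u`", §1.1). Mathlib's instance norm on `Fin d → ℤ` is the sup norm, hence a separate
definition. [cite: DuminilCopinHammond2013, §1.1] -/
def euclidNorm (u : Site d) : ℝ :=
  Real.sqrt (∑ i, ((u i : ℝ)) ^ 2)

/-- `‖0‖ = 0`. [cite: DuminilCopinHammond2013, §1.1] -/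
@[simp] theorem euclidNorm_zero : euclidNorm (0 : Site d) = 0 := by
  simp [euclidNorm]

/-- `‖u‖ ≥ 0`. [cite: DuminilCopinHammond2013, §1.1] -/
theorem euclidNorm_nonneg (u : Site d) : 0 ≤ euclidNorm u :=
  Real.sqrt_nonneg _

/-- `‖u‖² = Σ_i u_i²` (the Euclidean norm of §1.1). [cite: DuminilCopinHammond2013, §1.1] -/
theorem sq_euclidNorm (u : Site d) : euclidNorm u ^ 2 = ∑ i, ((u i : ℝ)) ^ 2 := by
  rw [euclidNorm, Real.sq_sqrt (Finset.sum_nonneg fun i _ => sq_nonneg _)]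

/-- A nearest neighbour of the origin has Euclidean norm `1` (one lattice step). [cite: DuminilCopinHammond2013, §1.1] -/
theorem euclidNorm_eq_one_of_adj_zero {u : Site d} (h : (zdGraph d).Adj 0 u) : euclidNorm u = 1 := by
  rw [zdGraph_adj_iff_sub] at h
  obtain ⟨i, hi⟩ := h
  have hu : u = Pi.single i 1 ∨ u = -Pi.single i 1 := by
    rcases hi with h1 | h1
    · left; simpa using h1
    · right; rw [zero_sub] at h1; rw [← h1, neg_neg]
  have hsq : ∀ j, ((u j : ℝ)) ^ 2 = if j = i then 1 else 0 := by
    intro j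
    rcases hu with rfl | rfl
    · by_cases hj : j = i
      · subst hj; simp
      · simp [hj]
    · by_cases hj : j = i
      · subst hj; simp
      · simp [hj]
  have hsum : ∑ j, ((u j : ℝ)) ^ 2 = 1 := by
    simp_rw [hsq]
    simp
  rw [euclidNorm, hsum, Real.sqrt_one]

/-! ### Theorem 1.1: sub-ballisticity -/

open Classical in
/-- The event `{γ ∈ SAW_n : max{‖γ_k‖ : 0 ≤ k ≤ n} ≥ v n}` of Theorem 1.1, as the sub-finset of
`saws d n` of walks some position of which, at a time `k ≤ n`, has Euclidean norm at least `v n`.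
[cite: DuminilCopinHammond2013, Thm 1.1] -/
def maxDisplacementEvent (d n : ℕ) (v : ℝ) : Finset (ℕ → Site d) :=
  (saws d n).filter fun ω => ∃ k ≤ n, v * n ≤ euclidNorm (ω k)

/-- Unfolding `maxDisplacementEvent`. [cite: DuminilCopinHammond2013, Thm 1.1] -/
theorem mem_maxDisplacementEvent {n : ℕ} {v : ℝ} {ω : ℕ → Site d} :
    ω ∈ maxDisplacementEvent d n v ↔ ω ∈ saws d n ∧ ∃ k ≤ n, v * n ≤ euclidNorm (ω k) := by
  classical
  exact Finset.mem_filter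

/-- The event is a sub-family of `SAW_n`, so its probability under the uniform law is
`#(event) / cₙ ≤ 1`. [cite: DuminilCopinHammond2013, Thm 1.1] -/
theorem card_maxDisplacementEvent_le (d n : ℕ) (v : ℝ) :
    (maxDisplacementEvent d n v).card ≤ count d n := by
  classical
  rw [maxDisplacementEvent, ← card_saws]
  exact Finset.card_filter_le _ _

/-- WITNESS for the reading note: for `v ≤ 1` EVERY one-step self-avoiding walk belongs to the event
of Theorem 1.1 at `n = 1` (`‖γ_1‖ = 1 ≥ v`), so `P_{SAW_1}(max_k ‖γ_k‖ ≥ v) = 1`, which is not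
`≤ e^{-ε}` for any `ε > 0`: the printed "for each `n ∈ ℕ`" must be read "for each `n ≥ n₀(v)`".
[cite: DuminilCopinHammond2013, Thm 1.1] -/
theorem dch_event_all_of_le_one {v : ℝ} (hv : v ≤ 1) :
    maxDisplacementEvent d 1 v = saws d 1 := by
  classical
  refine Finset.filter_true_of_mem fun ω hω => ⟨1, le_rfl, ?_⟩
  obtain ⟨h0, -, hadj, -⟩ := mem_saws.1 hω
  have h01 : (zdGraph d).Adj 0 (ω 1) := by simpa [h0] using hadj 0 Nat.one_pos
  rw [euclidNorm_eq_one_of_adj_zero h01]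
  simpa using hv

/-- NAMED FACT — **Duminil-Copin–Hammond 2013, Theorem 1.1 (self-avoiding walk is sub-ballistic)**:
"Let `d ≥ 2`. … Let `v > 0`. There exists `ε > 0` such that, for each `n ∈ ℕ` [read: for each
`n ≥ n₀(v)`, see the module docstring and `dch_event_all_of_le_one`],
`P_{SAW_n}( max{‖γ_k‖ : 0 ≤ k ≤ n} ≥ v n ) ≤ e^{-ε n}`", `P_{SAW_n}` the uniform law on the `n`-step
self-avoiding walks from `0` in `ℤ^d` and `‖·‖` the Euclidean norm; here the probability is the
ratio `#(event)/cₙ`. Users take `(h : DuminilCopinHammond2013_thm1_1)`.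
[cite: DuminilCopinHammond2013, Thm 1.1 (§1.1) and §2.4 (proof)] -/
def DuminilCopinHammond2013_thm1_1 : Prop :=
  ∀ d : ℕ, 2 ≤ d → ∀ v : ℝ, 0 < v → ∃ ε : ℝ, 0 < ε ∧ ∃ n₀ : ℕ, ∀ n : ℕ, n₀ ≤ n →
    ((maxDisplacementEvent d n v).card : ℝ) / (count d n : ℝ) ≤ Real.exp (-(ε * n))

/-! ### §2.2 and Theorem 2.5: irreducible bridges have infinite expected length -/

section Bridges

variable [NeZero d]

/-- **Renewal times** (§2.2): `i ∈ [0, n]` is a renewal time of the `n`-step walk `ω` (the source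
speaks of the renewal *point* `γ_i`) if both pieces `γ[0, i]` and `γ[i, n]` are bridges (in the tree's
convention of `IsBridge`: first coordinate, strict unique minimum at the start, maximum at the end).
[cite: DuminilCopinHammond2013, §2.2] -/
def IsRenewalTime (n : ℕ) (ω : ℕ → Site d) (i : ℕ) : Prop :=
  i ≤ n ∧ IsBridge i ω ∧ IsBridge (n - i) (fun k => ω (i + k))

/-- **Irreducible bridge** (§2.2): "A bridge `γ ∈ SAB_n` with `n ≥ 1` is said to be irreducible if `γ_k`
is not a renewal point for any `k ∈ [1, n-1]`." [cite: DuminilCopinHammond2013, §2.2] -/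
def IsIrreducibleBridge (n : ℕ) (ω : ℕ → Site d) : Prop :=
  1 ≤ n ∧ IsBridge n ω ∧ ∀ k, 1 ≤ k → k ≤ n - 1 → ¬ IsRenewalTime n ω k

open Classical in
/-- The `n`-step irreducible bridges from the origin (elements of `iSAB` of length `n`).
[cite: DuminilCopinHammond2013, §2.2] -/
def irreducibleBridges (d : ℕ) [NeZero d] (n : ℕ) : Finset (ℕ → Site d) :=
  (bridges d n).filter (IsIrreducibleBridge n)

/-- `λ_n`, the number of `n`-step irreducible bridges from the origin (`λ_0 = 0`).
[cite: DuminilCopinHammond2013, §2.2] -/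
def irreducibleBridgeCount (d : ℕ) [NeZero d] (n : ℕ) : ℕ :=
  (irreducibleBridges d n).card

/-- Membership in `irreducibleBridges`. [cite: DuminilCopinHammond2013, §2.2] -/
theorem mem_irreducibleBridges {n : ℕ} {ω : ℕ → Site d} :
    ω ∈ irreducibleBridges d n ↔ ω ∈ bridges d n ∧ IsIrreducibleBridge n ω := by
  classical
  exact Finset.mem_filter

/-- Irreducible bridges are bridges. [cite: DuminilCopinHammond2013, §2.2] -/
theorem irreducibleBridges_subset_bridges (n : ℕ) : irreducibleBridges d n ⊆ bridges d n := by
  classical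
  exact Finset.filter_subset _ _

/-- `λ_n ≤ b_n`. [cite: DuminilCopinHammond2013, §2.2] -/
theorem irreducibleBridgeCount_le_bridgeCount (n : ℕ) :
    irreducibleBridgeCount d n ≤ bridgeCount d n :=
  Finset.card_le_card (irreducibleBridges_subset_bridges n)

/-- There is no irreducible bridge of length `0` (`n ≥ 1` is part of the definition): `λ_0 = 0`.
[cite: DuminilCopinHammond2013, §2.2] -/
@[simp] theorem irreducibleBridgeCount_zero : irreducibleBridgeCount d 0 = 0 := by
  classical
  rw [irreducibleBridgeCount, Finset.card_eq_zero, irreducibleBridges, Finset.filter_eq_empty_iff]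
  intro ω _ h
  exact absurd h.1 (by omega)

/-- Every one-step bridge is irreducible (the range `k ∈ [1, n-1]` of forbidden renewal times is
empty for `n = 1`): `iSAB ∩ SAB_1 = SAB_1`. [cite: DuminilCopinHammond2013, §2.2] -/
theorem irreducibleBridges_one : irreducibleBridges d 1 = bridges d 1 := by
  classical
  rw [irreducibleBridges]
  refine Finset.filter_true_of_mem fun ω hω => ⟨le_rfl, (mem_bridges.1 hω).2, fun k h1 h2 => ?_⟩
  omega

/-- `λ_1 = b_1`. [cite: DuminilCopinHammond2013, §2.2] -/
theorem irreducibleBridgeCount_one : irreducibleBridgeCount d 1 = bridgeCount d 1 := by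
  rw [irreducibleBridgeCount, irreducibleBridges_one, bridgeCount]

/-- Non-vacuity: `λ_1 ≥ 1` (the one-step bridge `+e₁` is irreducible), so `iSAB ≠ ∅` and the series of
Theorem 2.5 has a positive term. [cite: DuminilCopinHammond2013, §2.2] -/
theorem one_le_irreducibleBridgeCount_one : 1 ≤ irreducibleBridgeCount d 1 := by
  rw [irreducibleBridgeCount_one]
  exact one_le_bridgeCount 1

end Bridges

/-- NAMED FACT — **Duminil-Copin–Hammond 2013, Theorem 2.5**: "We have that `E_{iSAB}(|γ|) = ∞`", where
`P_{iSAB}(γ) = μ_c^{-|γ|}` is the probability measure on the irreducible bridges from `0` in `ℤ^d`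
(`d ≥ 2`) given by Kesten's relation `Σ_{γ ∈ iSAB} μ_c^{-|γ|} = 1` (Lemma 2.2). Grouping by length,
`E_{iSAB}(|γ|) = Σ_n n λ_n μ^{-n}` (`λ_n = irreducibleBridgeCount d n`, `μ = connectiveConstant d`), a
series of nonnegative terms; the statement is that it diverges. Users take
`(h : DuminilCopinHammond2013_thm2_5)`. [cite: DuminilCopinHammond2013, Thm 2.5 (arXiv §2.3; proof §4)] -/
def DuminilCopinHammond2013_thm2_5 : Prop :=
  ∀ (d : ℕ) [NeZero d], 2 ≤ d →
    ¬ Summable fun n : ℕ =>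
      (n : ℝ) * (irreducibleBridgeCount d n : ℝ) * ((connectiveConstant d)⁻¹) ^ n

end Literature.Probability.RandomPlanarGeometry.SAW.Zd

end
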